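import Literature.NumberTheory.EllipticCurves.HeegnerEnvelopeDescentLucasProofs
import Literature.NumberTheory.EllipticCurves.HeegnerGeomCoherentPointIdentitiesProofs
import HarnessLib

/-!
# The `Λ`-adic stabilised Heegner class `κ_∞ = lim←_k κ_k ∈ 𝔖_p(K_∞)` of a coherent CGLS datum EXISTS
# (CGLS 2022 Rem. 4.1.4 «`κ_∞ := lim←_k κ_k`»; Perrin-Riou 1987 §3.3–3.4; proofs file)

Topic `NumberTheory/EllipticCurves`. THEOREMS ONLY (no definition, no named fact, no `sorry`, no instance);
sequel of `HeegnerEnvelopeDescentLucasProofs` / `CompactSelmerTowerNormProofs` /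
`Castella2024/LambdaAdicHeegnerClassExistence` (the Kummer-family API). Written by the cell `bsd-print-x9`
seat `bsd-line-x9-p2` (g2) for the shared μ-item of the cruxes stmt-BirchSwinnertonDyer-27077 (`PrintX9`) /
27275 (`PrintX10b`): the `SpecWitness.map_le` clause of the specialised-Kolyvagin-system port wants the
stabilised module `Λκ_∞(C) = stabilizedHeegnerModule D C` to be CYCLIC, generated by ONE class `κ_∞` whose
projections are CGLS's level classes `κ_k` (sequel file `HeegnerStabilizedModuleCyclicProofs`); this file
constructs that class.

THE CONSTRUCTION. Let `C` be a `d(k)`-shifted stabilised Heegner datum (`StabilizedHeegnerData`, torsion depth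
`δ`, norm points `u_k, v_k ∈ E(K_k)` for `k > δ`) which is COHERENT: above the depth its points satisfy the
identities exported by the tree's `exists_coherentPair` for an integer Lucas pair `(A, B)` and jumps `n_j` —
(P1′) `v_{j+1} = A_{n_j} • u_j + B_{n_j} • v_j`, (P1″) `v_{j+1}` is `K_j`-rational, (P2′)
`Σ_{i<p} γ^{p^j i} • u_{j+1} = A_{n_j+1} • u_j + B_{n_j+1} • v_j`. With `D_k = δ(u_k) − α⁻¹·δ(v_k)` (Kummer families over
`K_k`, `α` the unit root) the one-step descent of `HeegnerEnvelopeDescentLucasProofs` reads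
`𝒩_{k+1→k} D_{k+1} = α^{n_k+1} · res D_k`, so the rescaled families `y_k = α^{-E(k)} · D_k`,
`E(k) = d(δ+1) + Σ_{δ<j<k} (n_j + 1)`, are norm-compatible on the nose above the depth; below the depth one descends
the points themselves (`w_k = Σ_{i<p} γ^{p^k i} • w_{k+1}`, `K_k`-rational since `{γ^{p^k i}}_{i<p}` is a transversal of
`Gal(K̄/K_{k+1})` in `Gal(K̄/K_k)`). Kummer families are compact Selmer, so `LambdaAdicSelmerData.surj` yields
`κ_∞ ∈ 𝔖` with `proj_k κ_∞ = y_k = ε_k · x_k` for `k > δ`, `x_k = α^{-d(k)} D_k ∈ stabilizedClassLayer C k` (CGLS's `κ_k`),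
`ε_k = α^{d(k)} α^{-E(k)}` a unit — and `ε_k = 1` under the shift law `d(k+1) = d(k) + n_k + 1` of the tree's coherent
pairs (`n_j := d(j+1) − 1 − d(j)`): then `proj_k κ_∞ = κ_k` EXACTLY, print's «`κ_∞ := lim←_k κ_k`».

WHAT.
* §1 `smul_sum_topGenerator_pow_smul_eq` (`Σ_{i<p} γ^{p^m i} • x` is `K_m`-rational for `x` `K_{m+1}`-rational; the
  tree's `smul_sum_smul_eq_of_transversal` on the transversal `{γ^{p^m i}}_{i<p}`).
* §2 `stabilizedClassLayer_eq_of_mem` (two representatives of `δ(κ_k)` are equal), `exists_mem_stabilizedClassLayer`.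
* §3 `padicPi_mem_compactSelmerOver` (Literature copy of a Summits-side lemma: `ℤ_p`-multiples stay compact Selmer).
* §4 **`exists_proj_eq_padicPi_of_coherent`** — `∃ κ_∞ ∈ 𝔖, ∀ k > δ, proj_k κ_∞ = ε_k · x_k`, `x_k ∈ stabilizedClassLayer`,
  `ε_k ∈ ℤ_p^×`; **`exists_proj_mem_stabilizedClassLayer_of_coherent`** — under the shift law, `proj_k κ_∞ ∈
  stabilizedClassLayer C k` for all `k > δ`; `mem_stabilizedHeegnerModule_of_proj_eq_padicPi` (such a class lies in
  `Λκ_∞(C)`). Uniqueness and the cyclicity `Λκ_∞(C) = Λ ∙ κ_∞` are in the sequel `HeegnerStabilizedModuleCyclicProofs`.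
HONEST FRAMING: Kummer-theoretic bookkeeping of printed distribution relations over the tree's abstract
`𝔖_p(K_∞)`; nothing about any particular curve; «beyond-print theorem»: no; BSD is not proved by any of this.

References: [CastellaGrossiLeeSkinner2022] Rem. 4.1.4 (arXiv:2008.02571v2 TeX L2262–2294: `κ_k`, `κ_∞ := lim← κ_k`,
«generate the same Λ-submodule»); [PerrinRiou1987BSMF] §0 p. 402 (`𝔖_p`), §3.3 Prop. 3 / Cor. 5, §3.4 Prop. 10;
[Howard2004HeegnerKolyvagin] §3.3 (Kummer maps `δ_k`, `𝐇 = lim← H_k`); [BertoliniDarmon1996] §2.5 Prop. 2.7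
(norm-compatible points ⇒ Λ-adic class; the tree's `Castella2024.exists_isLambdaAdicHeegnerClass` is the model);
[Washington1997] §13.1 (`Gal(K_{n+1}/K_n) = ⟨γ^{pⁿ}⟩`).
-/

set_option autoImplicit false

noncomputable section

open scoped Classical

open WeierstrassCurve Literature.NumberTheory.EllipticCurves
  Literature.NumberTheory.EllipticCurves.CastellaGrossiLeeSkinner2022 PowerSeries

namespace Literature.NumberTheory.EllipticCurves

/-! ## §1 One-step norms along the anticyclotomic tower are rational one layer down -/

section OneStep

variable {K : Type} [Field K] {p : ℕ} [Fact p.Prime] (κ : ZpExtension K p)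
  {γ : Field.absoluteGaloisGroup K} {M : Type*} [AddCommMonoid M]
  [DistribMulAction (Field.absoluteGaloisGroup K) M]

/-- **`Σ_{i<p} γ^{p^m i} • x` is `K_m`-rational for `x` `K_{m+1}`-rational** (`{γ^{p^m i}}_{i<p}` is a transversal of
`Gal(K̄/K_{m+1})` in `Gal(K̄/K_m)`, `ZpExtension.existsUnique_topGenerator_pow`).
[cite: Washington1997, §13.1 (Gal(K_{n+1}/K_n) ≅ ℤ/p generated by γ^{p^n})] [cite: PerrinRiou1987BSMF, §3.3 (norms along the tower)] -/
theorem smul_sum_topGenerator_pow_smul_eq (hγ : κ.IsTopGenerator γ) (m : ℕ) {x : M}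
    (hx : ∀ σ ∈ κ.layerSubgroup (m + 1), σ • x = x) {τ : Field.absoluteGaloisGroup K}
    (hτ : τ ∈ κ.layerSubgroup m) :
    τ • ∑ i ∈ Finset.range p, (γ ^ (p ^ m * i)) • x = ∑ i ∈ Finset.range p, (γ ^ (p ^ m * i)) • x := by
  have hinj := ZpExtension.topGenerator_pow_injOn κ hγ m
  rw [← Finset.sum_image (f := fun r ↦ r • x) hinj]
  refine smul_sum_smul_eq_of_transversal (G := κ.layerSubgroup (m + 1)) (H := κ.layerSubgroup m) hx
    (fun r hr ↦ ?_) (ZpExtension.existsUnique_topGenerator_pow κ hγ m) hτ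
  obtain ⟨i, -, rfl⟩ := Finset.mem_image.mp hr
  exact ZpExtension.topGenerator_pow_mem_layerSubgroup κ hγ m i

end OneStep

/-! ## §2 The representatives of `δ(κ_k)` -/

section ClassLayer

variable {N : ℕ} [NeZero N] {W : WeierstrassCurve ℚ} [W.IsGloballyMinimal] [W.IsElliptic] {K : Type}
  [Field K] [NumberField K] {p : ℕ} [Fact p.Prime] {κ : ZpExtension K p}
  {jbar : AlgebraicClosure K →+* ℂ} (C : StabilizedHeegnerData N W K κ jbar) (k : ℕ) (hk : C.depth < k)

/-- **Two representatives of `δ(κ_k)` are equal** (`stabilizedClassLayer C k` is a singleton up to the choice of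
roots; Kummer families are unique, `IsKummerFamilyOver.unique`).
[cite: CastellaGrossiLeeSkinner2022, Rem. 4.1.4 (κ_k, arXiv:2008.02571v2 TeX L2268–2283)] -/
theorem stabilizedClassLayer_eq_of_mem {x x' : (W.baseChange K).torsionH1Pi p (κ.layerSubgroup k)}
    (hx : x ∈ stabilizedClassLayer C k hk) (hx' : x' ∈ stabilizedClassLayer C k hk) : x = x' := by
  obtain ⟨du, dv, hdu, hdv, rfl⟩ := hx
  obtain ⟨du', dv', hdu', hdv', rfl⟩ := hx'
  have hu : (W.baseChange K).IsKummerFamilyOver p (κ.layerSubgroup k) (fun σ hσ ↦ C.smul_u_eq hk hσ) du := hdu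
  have hu' : (W.baseChange K).IsKummerFamilyOver p (κ.layerSubgroup k) (fun σ hσ ↦ C.smul_u_eq hk hσ) du' :=
    hdu'
  have hv : (W.baseChange K).IsKummerFamilyOver p (κ.layerSubgroup k) (fun σ hσ ↦ C.smul_v_eq hk hσ) dv := hdv
  have hv' : (W.baseChange K).IsKummerFamilyOver p (κ.layerSubgroup k) (fun σ hσ ↦ C.smul_v_eq hk hσ) dv' :=
    hdv'
  rw [IsKummerFamilyOver.unique p hu hu', IsKummerFamilyOver.unique p hv hv']

/-- **`δ(κ_k)` has a representative** (Kummer families exist, `exists_isKummerFamilyOver`).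
[cite: CastellaGrossiLeeSkinner2022, Rem. 4.1.4 (κ_k)] -/
theorem exists_mem_stabilizedClassLayer :
    ∃ x : (W.baseChange K).torsionH1Pi p (κ.layerSubgroup k), x ∈ stabilizedClassLayer C k hk := by
  obtain ⟨du, hdu⟩ := exists_isKummerFamilyOver (W.baseChange K) p (κ.layerSubgroup k) (C.u k)
    (fun σ hσ ↦ C.smul_u_eq hk hσ)
  obtain ⟨dv, hdv⟩ := exists_isKummerFamilyOver (W.baseChange K) p (κ.layerSubgroup k) (C.v k)
    (fun σ hσ ↦ C.smul_v_eq hk hσ)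
  exact ⟨_, du, dv, hdu, hdv, rfl⟩

omit [W.IsElliptic] in
/-- **The stabilised difference at its own layer is `α^{d(k)}` times the representative**:
for Kummer families `du, dv` of `u_k, v_k` over `K_k`, `α^{-d(k)} · (du − α⁻¹ dv) ∈ stabilizedClassLayer C k`.
[cite: CastellaGrossiLeeSkinner2022, Rem. 4.1.4 (κ_k = α^{-d(k)} Norm P[p^{d(k)}]_α)] -/
theorem padicPi_kummerDiff_mem_stabilizedClassLayer
    {hu : ∀ σ ∈ κ.layerSubgroup k, σ • C.u k = C.u k} {hv : ∀ σ ∈ κ.layerSubgroup k, σ • C.v k = C.v k}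
    {du dv : (W.baseChange K).torsionH1Pi p (κ.layerSubgroup k)}
    (hdu : (W.baseChange K).IsKummerFamilyOver p (κ.layerSubgroup k) hu du)
    (hdv : (W.baseChange K).IsKummerFamilyOver p (κ.layerSubgroup k) hv dv) :
    (W.baseChange K).padicPi p (κ.layerSubgroup k) (Ring.inverse (unitRoot W p) ^ C.d k)
        (du - (W.baseChange K).padicPi p (κ.layerSubgroup k) (Ring.inverse (unitRoot W p)) dv) ∈
      stabilizedClassLayer C k hk :=
  ⟨du, dv, hdu, hdv, rfl⟩

end ClassLayer

/-! ## §3 `ℤ_p`-multiples of compact Selmer families -/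

section CompactSelmer

variable {K : Type} [Field K] [NumberField K] (V : WeierstrassCurve K) (p : ℕ) [Fact p.Prime]
  (H : Subgroup (Field.absoluteGaloisGroup K)) [H.Normal]

omit [NumberField K] [H.Normal] in
/-- Consecutive reductions of a `p`-adic integer agree modulo `p^k`: `p^k ∣ (c mod p^{k+1}).val − (c mod p^k).val`
(`PadicInt.cast_toZModPow`; Literature copy of a Summits-side lemma of the K7r cell).
[cite: SerreLocalFields1979, II.§1 (ℤ_p = lim ℤ/p^k)] -/
theorem pow_dvd_toZModPow_succ_val_sub (c : ℤ_[p]) (k : ℕ) :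
    ((p : ℤ) ^ k) ∣ ((PadicInt.toZModPow (k + 1) c).val : ℤ) - ((PadicInt.toZModPow k c).val : ℤ) := by
  haveI : NeZero (p ^ k) := ⟨pow_ne_zero _ (Fact.out : p.Prime).ne_zero⟩
  have h : (((PadicInt.toZModPow k c).val : ℤ) : ZMod (p ^ k)) =
      (((PadicInt.toZModPow (k + 1) c).val : ℤ) : ZMod (p ^ k)) := by
    rw [Int.cast_natCast, Int.cast_natCast, ZMod.natCast_zmod_val, ZMod.natCast_val,
      PadicInt.cast_toZModPow k (k + 1) (Nat.le_succ k) c]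
  have := (ZMod.intCast_eq_intCast_iff_dvd_sub _ _ (p ^ k)).1 h
  simpa only [Nat.cast_pow] using this

/-- **`ℤ_p`-multiples preserve the compact Selmer group** `S_p(E/L)`: levelwise Selmer is a subgroup and the
`p_*`-compatibility survives because `c mod p^{k+1} ≡ c mod p^k (mod p^k)` and `p^k` kills level `k`
(Literature copy of a Summits-side lemma of the K7r cell). [cite: PerrinRiou1987BSMF, §0 p. 401 («des ℤ_p-modules compacts»)] -/
theorem padicPi_mem_compactSelmerOver (c : ℤ_[p]) {x : V.torsionH1Pi p H} (hx : x ∈ V.compactSelmerOver H p) :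
    V.padicPi p H c x ∈ V.compactSelmerOver H p := by
  rw [mem_compactSelmerOver_iff] at hx ⊢
  refine ⟨fun k ↦ ?_, fun k ↦ ?_⟩
  · rw [padicPi_apply]
    exact AddSubgroup.zsmul_mem _ (hx.1 k) _
  · rw [padicPi_apply, padicPi_apply, map_zsmul, hx.2 k]
    obtain ⟨q, hq⟩ := pow_dvd_toZModPow_succ_val_sub p c k
    have h0 : (((p : ℤ) ^ k) * q) • x k = 0 := by
      rw [mul_comm, mul_zsmul, V.pow_smul_torsionH1Over_eq_zero H p k (x k), zsmul_zero]
    calc ((PadicInt.toZModPow (k + 1) c).val : ℤ) • x k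
        = (((PadicInt.toZModPow (k + 1) c).val : ℤ) - ((PadicInt.toZModPow k c).val : ℤ)) • x k +
            ((PadicInt.toZModPow k c).val : ℤ) • x k := by rw [← add_zsmul, sub_add_cancel]
      _ = ((PadicInt.toZModPow k c).val : ℤ) • x k := by rw [hq, h0, zero_add]

end CompactSelmer

/-! ## §4 The `Λ`-adic stabilised class `κ_∞` -/

section Existence

variable {N : ℕ} [NeZero N] {W : WeierstrassCurve ℚ} [W.IsGloballyMinimal] [W.IsElliptic] {K : Type}
  [Field K] [NumberField K] {p : ℕ} [Fact p.Prime] {κ : ZpExtension K p} {γ : Field.absoluteGaloisGroup K}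
  {jbar : AlgebraicClosure K →+* ℂ} (D : (W.baseChange K).LambdaAdicSelmerData κ γ)
  (C : StabilizedHeegnerData N W K κ jbar)

/-- **EXISTENCE OF THE `Λ`-ADIC STABILISED CLASS** `κ_∞ ∈ 𝔖_p(K_∞)` of a coherent CGLS datum: under
(P1′)/(P1″)/(P2′) for an integer Lucas pair `(A, B)` and jumps `ns`, at a good ordinary `p` with `γ` a
topological generator, there is `κ_∞ ∈ 𝔖` whose projection to EVERY layer `k > δ` is `ε_k · x_k` with `x_k`
a representative of CGLS's `δ(κ_k)` (`stabilizedClassLayer C k`) and the explicit unit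
`ε_k = α^{d(k)} · α^{-(d(δ+1) + Σ_{δ<j<k} (ns j + 1))}`. Construction in the module docstring
(rescaled stabilised differences above the depth, descended points below it, `LambdaAdicSelmerData.surj`).
[cite: CastellaGrossiLeeSkinner2022, Rem. 4.1.4 (κ_∞ := lim←_k κ_k, arXiv:2008.02571v2 TeX L2278–2283)]
[cite: PerrinRiou1987BSMF, §0 p. 402 and §3.4 Prop. 10] [cite: BertoliniDarmon1996, §2.5 Prop. 2.7] -/
theorem exists_proj_eq_padicPi_of_coherent (hord : IsOrdinaryAt W p) (hγ : κ.IsTopGenerator γ)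
    (A B : ℕ → ℤ) (hA0 : A 0 = 1) (hA1 : A 1 = W.frobeniusTrace p)
    (hA : ∀ m, A (m + 2) = W.frobeniusTrace p * A (m + 1) - p * A m)
    (hB0 : B 0 = 0) (hB1 : B 1 = -1) (hB : ∀ m, B (m + 2) = W.frobeniusTrace p * B (m + 1) - p * B m)
    (ns : ℕ → ℕ) (hv1 : ∀ j, C.depth < j → C.v (j + 1) = A (ns j) • C.u j + B (ns j) • C.v j)
    (hvfix : ∀ j, C.depth < j → ∀ σ ∈ κ.layerSubgroup j, σ • C.v (j + 1) = C.v (j + 1))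
    (hnorm : ∀ j, C.depth < j →
      ∑ i ∈ Finset.range p, (γ ^ (p ^ j * i)) • C.u (j + 1) = A (ns j + 1) • C.u j + B (ns j + 1) • C.v j) :
    ∃ z : D.S, ∀ (k : ℕ) (hk : C.depth < k),
      ∃ x ∈ stabilizedClassLayer C k hk,
        D.proj k z = (W.baseChange K).padicPi p (κ.layerSubgroup k)
          (unitRoot W p ^ C.d k * Ring.inverse (unitRoot W p) ^
            (C.d (C.depth + 1) + ∑ j ∈ Finset.Ico (C.depth + 1) k, (ns j + 1))) x := by
  have hunit : IsUnit (unitRoot W p) := (unitRoot_spec_holds W p hord).2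
  -- the points BELOW the depth: `wu n`, `wv n` live on the layer `δ + 1 - n`
  let wu : ℕ → geomPoints (W.baseChange K) := fun n ↦
    Nat.rec (C.u (C.depth + 1)) (fun n w ↦ ∑ i ∈ Finset.range p, (γ ^ (p ^ (C.depth - n) * i)) • w) n
  let wv : ℕ → geomPoints (W.baseChange K) := fun n ↦
    Nat.rec (C.v (C.depth + 1)) (fun n w ↦ ∑ i ∈ Finset.range p, (γ ^ (p ^ (C.depth - n) * i)) • w) n
  have hwu0 : wu 0 = C.u (C.depth + 1) := rfl
  have hwv0 : wv 0 = C.v (C.depth + 1) := rfl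
  have hwu_succ : ∀ n, wu (n + 1) = ∑ i ∈ Finset.range p, (γ ^ (p ^ (C.depth - n) * i)) • wu n :=
    fun n ↦ rfl
  have hwv_succ : ∀ n, wv (n + 1) = ∑ i ∈ Finset.range p, (γ ^ (p ^ (C.depth - n) * i)) • wv n :=
    fun n ↦ rfl
  have hw_fix : ∀ w : ℕ → geomPoints (W.baseChange K), (∀ σ ∈ κ.layerSubgroup (C.depth + 1), σ • w 0 = w 0) →
      (∀ n, w (n + 1) = ∑ i ∈ Finset.range p, (γ ^ (p ^ (C.depth - n) * i)) • w n) →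
      ∀ n k, n + k = C.depth + 1 → ∀ σ ∈ κ.layerSubgroup k, σ • w n = w n := by
    intro w h0 hsucc n
    induction n with
    | zero =>
      intro k hk σ hσ
      obtain rfl : k = C.depth + 1 := by omega
      exact h0 σ hσ
    | succ n ih =>
      intro k hk σ hσ
      have hdn : C.depth - n = k := by omega
      rw [hsucc, hdn]
      exact smul_sum_topGenerator_pow_smul_eq κ hγ k (ih (k + 1) (by omega)) hσ
  have hwu_fix := hw_fix wu (fun σ hσ ↦ C.smul_u_eq (Nat.lt_succ_self _) hσ) hwu_succ
  have hwv_fix := hw_fix wv (fun σ hσ ↦ C.smul_v_eq (Nat.lt_succ_self _) hσ) hwv_succ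
  -- the points at every layer
  let U : ℕ → geomPoints (W.baseChange K) := fun k ↦ if C.depth < k then C.u k else wu (C.depth + 1 - k)
  let Vp : ℕ → geomPoints (W.baseChange K) := fun k ↦ if C.depth < k then C.v k else wv (C.depth + 1 - k)
  have hU_of_lt : ∀ k, C.depth < k → U k = C.u k := fun k hk ↦ if_pos hk
  have hV_of_lt : ∀ k, C.depth < k → Vp k = C.v k := fun k hk ↦ if_pos hk
  have hU_fix : ∀ k, ∀ σ ∈ κ.layerSubgroup k, σ • U k = U k := by
    intro k σ hσ
    by_cases hk : C.depth < k
    · rw [hU_of_lt k hk]; exact C.smul_u_eq hk hσ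
    · have hUk : U k = wu (C.depth + 1 - k) := if_neg hk
      rw [hUk]
      exact hwu_fix _ k (by omega) σ hσ
  have hV_fix : ∀ k, ∀ σ ∈ κ.layerSubgroup k, σ • Vp k = Vp k := by
    intro k σ hσ
    by_cases hk : C.depth < k
    · rw [hV_of_lt k hk]; exact C.smul_v_eq hk hσ
    · have hVk : Vp k = wv (C.depth + 1 - k) := if_neg hk
      rw [hVk]
      exact hwv_fix _ k (by omega) σ hσ
  -- the one-step recursion below the depth
  have hrec : ∀ P w : ℕ → geomPoints (W.baseChange K), (∀ k, ¬ C.depth < k → P k = w (C.depth + 1 - k)) →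
      P (C.depth + 1) = w 0 → (∀ n, w (n + 1) = ∑ i ∈ Finset.range p, (γ ^ (p ^ (C.depth - n) * i)) • w n) →
      ∀ k, k ≤ C.depth → P k = ∑ i ∈ Finset.range p, (γ ^ (p ^ k * i)) • P (k + 1) := by
    intro P w hP hP0 hsucc k hk
    have hPk : P k = w (C.depth - k + 1) := by
      rw [hP k (not_lt.mpr hk), show C.depth + 1 - k = C.depth - k + 1 by omega]
    have hPk1 : P (k + 1) = w (C.depth - k) := by
      rcases hk.lt_or_eq with hlt | rfl
      · rw [hP (k + 1) (by omega), show C.depth + 1 - (k + 1) = C.depth - k by omega]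
      · rw [hP0, Nat.sub_self]
    rw [hPk, hPk1, hsucc, show C.depth - (C.depth - k) = k by omega]
  have hU_rec := hrec U wu (fun k hk ↦ if_neg hk) (hU_of_lt _ (Nat.lt_succ_self _)) hwu_succ
  have hV_rec := hrec Vp wv (fun k hk ↦ if_neg hk) (hV_of_lt _ (Nat.lt_succ_self _)) hwv_succ
  -- Kummer families at every layer
  choose du hdu using fun k ↦ exists_isKummerFamilyOver (W.baseChange K) p (κ.layerSubgroup k) (U k) (hU_fix k)
  choose dv hdv using fun k ↦ exists_isKummerFamilyOver (W.baseChange K) p (κ.layerSubgroup k) (Vp k) (hV_fix k)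
  -- the exponents and the rescaled stabilised differences
  let E : ℕ → ℕ := fun k ↦ C.d (C.depth + 1) + ∑ j ∈ Finset.Ico (C.depth + 1) k, (ns j + 1)
  have hE_succ : ∀ n, C.depth < n → E (n + 1) = E n + (ns n + 1) := by
    intro n hn
    simp only [E]
    rw [Finset.sum_Ico_succ_top (Nat.succ_le_of_lt hn), add_assoc]
  have hE_le : ∀ n, n ≤ C.depth + 1 → E n = C.d (C.depth + 1) := by
    intro n hn
    simp only [E]
    rw [Finset.Ico_eq_empty (by omega), Finset.sum_empty, add_zero]
  let y : Π n k : ℕ, (W.baseChange K).torsionH1Over ((p : ℤ) ^ k) (κ.layerSubgroup n) := fun n ↦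
    (W.baseChange K).padicPi p (κ.layerSubgroup n) (Ring.inverse (unitRoot W p) ^ E n)
      (du n - (W.baseChange K).padicPi p (κ.layerSubgroup n) (Ring.inverse (unitRoot W p)) (dv n))
  have hy : ∀ n, y n = (W.baseChange K).padicPi p (κ.layerSubgroup n) (Ring.inverse (unitRoot W p) ^ E n)
      (du n - (W.baseChange K).padicPi p (κ.layerSubgroup n) (Ring.inverse (unitRoot W p)) (dv n)) :=
    fun n ↦ rfl
  -- compact Selmer
  have hsel : ∀ n, y n ∈ (W.baseChange K).compactSelmerOver (κ.layerSubgroup n) p := fun n ↦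
    padicPi_mem_compactSelmerOver _ p _ _ (AddSubgroup.sub_mem _ (hdu n).mem_compactSelmerOver
      (padicPi_mem_compactSelmerOver _ p _ _ (hdv n).mem_compactSelmerOver))
  -- norm compatibility
  have hnormrel : ∀ n, (W.baseChange K).resPi p (κ.layerSubgroup_antitone (Nat.le_succ n)) (y n) =
      ∑ i ∈ Finset.range p, (W.baseChange K).conjPi p (κ.layerSubgroup (n + 1)) (γ ^ (p ^ n * i))
        (y (n + 1)) := by
    intro n
    have hle : κ.layerSubgroup (n + 1) ≤ κ.layerSubgroup n := κ.layerSubgroup_antitone (Nat.le_succ n)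
    -- the Kummer families over `K_{n+1}` of `U n`, `Vp n`
    have hdun := (hdu n).resPi (p := p) hle
    have hdvn := (hdv n).resPi (p := p) hle
    rw [hy n, hy (n + 1), resPi_padicPi, map_sub, resPi_padicPi, sum_conjPi_padicPi]
    by_cases hn : C.depth < n
    · -- above the depth: the one-step descent of the stabilised differences
      have hn1 : C.depth < n + 1 := Nat.lt_succ_of_lt hn
      have hdun' := IsKummerFamilyOver.of_eq (hP' := fun σ hσ ↦ C.smul_u_eq hn (hle hσ)) (hU_of_lt n hn) hdun
      have hdvn' := IsKummerFamilyOver.of_eq (hP' := fun σ hσ ↦ C.smul_v_eq hn (hle hσ)) (hV_of_lt n hn) hdvn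
      have hdu1 := IsKummerFamilyOver.of_eq (hP' := fun σ hσ ↦ C.smul_u_eq hn1 hσ) (hU_of_lt (n + 1) hn1)
        (hdu (n + 1))
      have hdv1 := IsKummerFamilyOver.of_eq (hP' := fun σ hσ ↦ C.smul_v_eq hn1 hσ) (hV_of_lt (n + 1) hn1)
        (hdv (n + 1))
      have hc : Ring.inverse (unitRoot W p) ^ E (n + 1) * unitRoot W p ^ (ns n + 1) =
          Ring.inverse (unitRoot W p) ^ E n := by
        rw [hE_succ n hn, pow_add, mul_assoc, mul_comm (Ring.inverse (unitRoot W p) ^ (ns n + 1)),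
          unitRoot_pow_mul_ringInverse_pow W p hord, mul_one]
      rw [sum_conjPi_kummerDiff_eq_unitRoot_pow_succ_smul C hord hγ A B hA0 hA1 hA hB0 hB1 hB hle
        (hv1 n hn) (hvfix n hn) (hnorm n hn) hdu1 hdv1 hdun' hdvn', padicPi_padicPi, hc]
    · -- below the depth: the points themselves are norms
      have hn' : n ≤ C.depth := not_lt.mp hn
      have hEn : E (n + 1) = E n := by rw [hE_le n (by omega), hE_le (n + 1) (by omega)]
      have hsumu := IsKummerFamilyOver.of_eq (hP' := fun σ hσ ↦ hU_fix n σ (hle hσ)) (hU_rec n hn').symm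
        (IsKummerFamilyOver.sum (Finset.range p) fun i ↦ (hdu (n + 1)).conjPi (γ ^ (p ^ n * i)))
      have hsumv := IsKummerFamilyOver.of_eq (hP' := fun σ hσ ↦ hV_fix n σ (hle hσ)) (hV_rec n hn').symm
        (IsKummerFamilyOver.sum (Finset.range p) fun i ↦ (hdv (n + 1)).conjPi (γ ^ (p ^ n * i)))
      rw [hEn, sum_conjPi_sub, sum_conjPi_padicPi, IsKummerFamilyOver.unique p hdun hsumu,
        IsKummerFamilyOver.unique p hdvn hsumv]
  -- the class
  obtain ⟨z, hz⟩ := D.surj y hsel hnormrel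
  refine ⟨z, fun k hk ↦ ?_⟩
  have hduk := IsKummerFamilyOver.of_eq (hP' := fun σ hσ ↦ C.smul_u_eq hk hσ) (hU_of_lt k hk) (hdu k)
  have hdvk := IsKummerFamilyOver.of_eq (hP' := fun σ hσ ↦ C.smul_v_eq hk hσ) (hV_of_lt k hk) (hdv k)
  refine ⟨_, padicPi_kummerDiff_mem_stabilizedClassLayer C k hk hduk hdvk, ?_⟩
  rw [hz k, hy k, padicPi_padicPi, mul_right_comm, unitRoot_pow_mul_ringInverse_pow W p hord, one_mul]

/-- **The `Λ`-adic stabilised class, unit form**: `∃ κ_∞ ∈ 𝔖, ∀ k > δ, proj_k κ_∞ = ε_k · x_k` with `ε_k ∈ ℤ_p^×`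
and `x_k ∈ stabilizedClassLayer C k` (the shape consumed by the cyclicity file).
[cite: CastellaGrossiLeeSkinner2022, Rem. 4.1.4 (κ_∞ := lim←_k κ_k)] [cite: PerrinRiou1987BSMF, §3.4 Prop. 10] -/
theorem exists_proj_eq_padicPi_unit_of_coherent (hord : IsOrdinaryAt W p) (hγ : κ.IsTopGenerator γ)
    (A B : ℕ → ℤ) (hA0 : A 0 = 1) (hA1 : A 1 = W.frobeniusTrace p)
    (hA : ∀ m, A (m + 2) = W.frobeniusTrace p * A (m + 1) - p * A m)
    (hB0 : B 0 = 0) (hB1 : B 1 = -1) (hB : ∀ m, B (m + 2) = W.frobeniusTrace p * B (m + 1) - p * B m)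
    (ns : ℕ → ℕ) (hv1 : ∀ j, C.depth < j → C.v (j + 1) = A (ns j) • C.u j + B (ns j) • C.v j)
    (hvfix : ∀ j, C.depth < j → ∀ σ ∈ κ.layerSubgroup j, σ • C.v (j + 1) = C.v (j + 1))
    (hnorm : ∀ j, C.depth < j →
      ∑ i ∈ Finset.range p, (γ ^ (p ^ j * i)) • C.u (j + 1) = A (ns j + 1) • C.u j + B (ns j + 1) • C.v j) :
    ∃ z : D.S, ∀ (k : ℕ) (hk : C.depth < k), ∃ e : ℤ_[p], IsUnit e ∧ ∃ x ∈ stabilizedClassLayer C k hk,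
      D.proj k z = (W.baseChange K).padicPi p (κ.layerSubgroup k) e x := by
  have hunit : IsUnit (unitRoot W p) := (unitRoot_spec_holds W p hord).2
  obtain ⟨z, hz⟩ := exists_proj_eq_padicPi_of_coherent D C hord hγ A B hA0 hA1 hA hB0 hB1 hB ns hv1 hvfix hnorm
  refine ⟨z, fun k hk ↦ ⟨_, ?_, hz k hk⟩⟩
  exact (hunit.pow _).mul (hunit.ringInverse.pow _)

/-- **The `Λ`-adic stabilised class with EXACT projections** under the shift law `d(k+1) = d(k) + ns k + 1`
(`k > δ`; the law of the tree's coherent pairs, whose jumps are `ns j := d(j+1) − 1 − d(j)`): `∃ κ_∞ ∈ 𝔖` with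
`proj_k κ_∞ ∈ stabilizedClassLayer C k` — i.e. `proj_k κ_∞ = δ(κ_k)` — for every `k > δ`; print's
«`κ_∞ := lim←_k κ_k`». [cite: CastellaGrossiLeeSkinner2022, Rem. 4.1.4 (κ_∞ := lim←_k κ_k, arXiv:2008.02571v2 TeX L2278–2283)]
[cite: PerrinRiou1987BSMF, §3.4 Prop. 10] -/
theorem exists_proj_mem_stabilizedClassLayer_of_coherent (hord : IsOrdinaryAt W p) (hγ : κ.IsTopGenerator γ)
    (A B : ℕ → ℤ) (hA0 : A 0 = 1) (hA1 : A 1 = W.frobeniusTrace p)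
    (hA : ∀ m, A (m + 2) = W.frobeniusTrace p * A (m + 1) - p * A m)
    (hB0 : B 0 = 0) (hB1 : B 1 = -1) (hB : ∀ m, B (m + 2) = W.frobeniusTrace p * B (m + 1) - p * B m)
    (ns : ℕ → ℕ) (hv1 : ∀ j, C.depth < j → C.v (j + 1) = A (ns j) • C.u j + B (ns j) • C.v j)
    (hvfix : ∀ j, C.depth < j → ∀ σ ∈ κ.layerSubgroup j, σ • C.v (j + 1) = C.v (j + 1))
    (hnorm : ∀ j, C.depth < j →
      ∑ i ∈ Finset.range p, (γ ^ (p ^ j * i)) • C.u (j + 1) = A (ns j + 1) • C.u j + B (ns j + 1) • C.v j)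
    (hd : ∀ j, C.depth < j → C.d (j + 1) = C.d j + ns j + 1) :
    ∃ z : D.S, ∀ (k : ℕ) (hk : C.depth < k), D.proj k z ∈ stabilizedClassLayer C k hk := by
  obtain ⟨z, hz⟩ := exists_proj_eq_padicPi_of_coherent D C hord hγ A B hA0 hA1 hA hB0 hB1 hB ns hv1 hvfix hnorm
  -- under the shift law the exponent `E(k)` is `d(k)`
  have hE : ∀ m, C.d (C.depth + 1) + ∑ j ∈ Finset.Ico (C.depth + 1) (C.depth + 1 + m), (ns j + 1) =
      C.d (C.depth + 1 + m) := by
    intro m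
    induction m with
    | zero => rw [add_zero, Finset.Ico_self, Finset.sum_empty, add_zero]
    | succ m ih =>
      rw [← add_assoc, Finset.sum_Ico_succ_top (Nat.le_add_right _ _), ← add_assoc, ih,
        hd _ (by omega)]
      ring
  refine ⟨z, fun k hk ↦ ?_⟩
  obtain ⟨x, hx, hzx⟩ := hz k hk
  obtain ⟨m, rfl⟩ : ∃ m, k = C.depth + 1 + m := ⟨k - (C.depth + 1), by omega⟩
  rw [hE m, unitRoot_pow_mul_ringInverse_pow W p hord, padicPi_one] at hzx
  rwa [hzx]

omit [W.IsElliptic] in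
/-- **A class with projections `ε_k · δ(κ_k)` above the depth lies in `Λκ_∞(C)`** (`stabilizedHeegnerModule D C` is
spanned by exactly such elements; layers `k ≤ δ` impose nothing).
[cite: CastellaGrossiLeeSkinner2022, Rem. 4.1.4 (Λκ_∞)] -/
theorem mem_stabilizedHeegnerModule_of_proj_eq_padicPi {z : D.S}
    (hz : ∀ (k : ℕ) (hk : C.depth < k), ∃ e : ℤ_[p], ∃ x ∈ stabilizedClassLayer C k hk,
      D.proj k z = (W.baseChange K).padicPi p (κ.layerSubgroup k) e x) :
    z ∈ stabilizedHeegnerModule D C := by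
  refine mem_stabilizedHeegnerModule_of_proj_mem D C fun k hk ↦ ?_
  obtain ⟨e, x, hx, hzx⟩ := hz k hk
  rw [hzx]
  exact padicPi_mem_stabilizedModuleLayer γ C k hk e (mem_stabilizedModuleLayer_of_mem_stabilizedClassLayer γ C k hk hx)

end Existence


end Literature.NumberTheory.EllipticCurves

end
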